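import Summits.FinalStateConjecture.FinalStateConjecture.Theorems.StarvedNecksNecksCertifyReductionZero
import Summits.FinalStateConjecture.FinalStateConjecture.Theorems.GapDecaySuffices.Negative.RelabelDecomposition
import Literature.Geometry.Lorentzian.BackgroundChartCalculus
import HarnessLib.Audit

/-!
# Headers to register (lead): parity-relabel bricks for `stub_assembly`, line `Sketch` (S5v2 worker, wave 2)

`ledger propose … --supports stmt-FinalStateConjecture-18060` BOUNCES (p142299, `supports.stub-mismatch`) unless the
file proves a REGISTERED stub by name + signature.  Paste the four theorem headers below VERBATIM into
`Cruxes/GapDecaySuffices/Lines/Sketch.lean` (this file elaborates with the skeleton's imports PLUS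
`import Literature.Geometry.Lorentzian.BackgroundChartCalculus` (for `bilinPullback`) and
`import Summits.FinalStateConjecture.FinalStateConjecture.Theorems.GapDecaySuffices.Negative.RelabelDecomposition`
(for `HonestCoreOf`, `DistinctLabels`); bodies `sorry` until the brick files land, then
`:= Theorems.GapDecaySuffices.Relabel.stub_… …`).  Brick k proves header Hk (all four files: `lean check` rc 0,
0 errors, 0 warnings, 0 sorries as the concatenation `work/stubs/RelabelMono.lean`; each ≤ 400 lines, docstrings
on every declaration; files 2–4 import file 1 by its TARGET module name, so they can only be gate-checked after
file 1 is ACCEPTED — landing order 1 → {2, 3} → 4; all contain `def`s ⇒ kind=definition ⇒ review queue):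

* H1 `stub_supCkENormPullbackAffine` — `work/stubs/RelabelPullbackNorms.lean` (391 lines; `ParityDatum Λ` =
  Lorentz involution `Q` fixing `∂₀`, `Λ⁻¹∂₀`, `x³`; `oneDatum`; `relabelMotion P = Λ * P.Q`, `labRefl`, `reflAffine`
  (`Q̃`), covariance of the boosted Kerr background, `supCkENorm_bilinPullback_affine`)
  → `Summits/FinalStateConjecture/FinalStateConjecture/Theorems/StarvedNecksGapDecaySufficesRelabelPullbackNorms.lean`
* H2 `stub_parityReflection` — `work/stubs/RelabelReflection.lean` (213 lines; `axisRefl`, `holeDatum Λ`,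
  `det = −1`, `det_fderiv_reflAffine_holeDatum`) → `…/Theorems/StarvedNecksGapDecaySufficesRelabelReflection.lean`
* H3 `stub_deviationExtendParity` — `work/stubs/RelabelChartTransfer.lean` (400 lines; `reflDom`, `relabelChart`,
  `mfderiv_relabelChart_apply`, `deviationExtend_relabelChart`, `supCkENorm_deviationExtend_relabelChart(_setOf)`,
  `isLateChart_relabelChart`, `truncDeviationCk_relabelChart`, image lemmas)
  → `…/Theorems/StarvedNecksGapDecaySufficesRelabelChartTransfer.lean`
* H4 `stub_parityRelabelDecomposition` — `work/stubs/RelabelEach.lean` (400 lines; `relabelEach d P` +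
  `relabelEach_charted/region/time/radius/image_setOf`, `honestCore_relabelEach`, `distinctLabels_relabelEach`,
  `honestFar_relabelEach` (from a bound on the REFLECTED cells), `honestFar_relabelEach_of_N_eq_one`,
  `gapCertificateAt_relabelEach` (hypothesis/conclusion verbatim `GapCertificateAt`))
  → `…/Theorems/StarvedNecksGapDecaySufficesRelabelEach.lean`

## OBSTRUCTION found while proving (1): `Hf`(3) is NOT invariant under per-label parity relabelling, `d.N ≥ 2`

`(relabelEach d P).chart i = Ψᵢ ∘ Q̃ᵢ` has `C⁰` deviation at `x` equal to that of `Ψᵢ` at `Q̃ᵢ x`; the honest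
cell `Cᵢ(T) = {T ≤ tᵢ, R₀ ≤ rᵢ ≤ rⱼ ∀ j ≠ i}` is defined by ALL radii, and `Q̃ᵢ` preserves `tᵢ, rᵢ, x⁰` but NOT
`rⱼ` (`j ≠ i`): `Q̃ᵢ Cᵢ ⊄ Cᵢ` — points of `Cᵢ` near the `Q̃ᵢ`-mirror image of another hole's line `ℓⱼ` are sent
next to `ℓⱼ`, where `Hc`/`Hf` say nothing about `Ψᵢ`.  So `HonestFar (relabelEach d P) R₀'` does not follow from
the antecedent for any `R₀'` when `d.N ≥ 2` and some `P i` is a genuine reflection (it does for `d.N = 1`, and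
for GLOBAL relabellings = the disprover's `relabel d Δ`, which however flip ALL parities at once and move the label
lines, breaking `TubeAnchoredR` for `N ≥ 3`).  The same non-invariance hits the Voronoi clause `rᵢ x ≤ rⱼ x` of the
`TubeAnchoredR` witness (there curable by cone separation once the witness is late in flat time).  Consequence for
plan (ii) of S5v2: for mixed-parity inputs with `N ≥ 2` the relabelled `d'` cannot be `relabelEach d P`; a
parity-fixing `d'` with `d'.charted = d.charted`, `C⁴` near zones and `Hf`(3) needs a different far behaviour of the
reflected hole chart (the obvious glue `Ψᵢ∘Q̃ᵢ` inside / `Φ` outside changes `region i`, hence `charted`).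

## What remains of `stub_assembly` after these bricks

(ii) parity: the orientation test (sign of `det D(Ψg⁻¹ ∘ Φ)` on the anchored collar, constant by connectedness)
and a parity-fixing relabelling compatible with `Hf`(3) for `N ≥ 2` (above); (iii) the per-hole construction
(`ρ'` least concave majorant, S4 location, S3 switch-off, `Ψₐ`); (iv) K1–K13 bookkeeping.  Nothing of (iii)–(iv)
is in these files.
-/


noncomputable section

open scoped Manifold ContDiff Topology ENNReal
open Filter Set MeasureTheory Topology Literature.Geometry.Lorentzian

namespace Summit.FinalStateConjecture.FinalStateConjecture.Cruxes.GapDecaySuffices.Sketch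

set_option linter.dupNamespace false
set_option linter.unusedVariables false

/-- Registered brick (H1). -/
theorem stub_supCkENormPullbackAffine {E : Type*} [NormedAddCommGroup E] [NormedSpace ℝ E]
    (L : E ≃ₗᵢ[ℝ] E) (c c' : E) (θ : E → E) (hθ : ∀ x, θ x = c + L (x - c')) (S : Set E) (k : ℕ)
    (F : E → E →L[ℝ] E →L[ℝ] ℝ) :
    supCkENorm S k (bilinPullback θ F) = supCkENorm (θ '' S) k F := by
  sorry

/-- Registered brick (H2). -/
theorem stub_parityReflection (Λ : lorentzGroup) :
    ∃ Q : lorentzGroup, (∀ v, (Q : E4 ≃L[ℝ] E4) ((Q : E4 ≃L[ℝ] E4) v) = v) ∧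
      (Q : E4 ≃L[ℝ] E4) (E4.basisVector 0) = E4.basisVector 0 ∧
      (Q : E4 ≃L[ℝ] E4) ((Λ : E4 ≃L[ℝ] E4).symm (E4.basisVector 0)) =
        (Λ : E4 ≃L[ℝ] E4).symm (E4.basisVector 0) ∧
      (∀ v, (Q : E4 ≃L[ℝ] E4) v 3 = v 3) ∧ (∀ v, ‖(Q : E4 ≃L[ℝ] E4) v‖ = ‖v‖) ∧
      LinearMap.det ((Q : E4 ≃L[ℝ] E4) : E4 →ₗ[ℝ] E4) = -1 := by
  sorry

/-- Registered brick (H3). -/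
theorem stub_deviationExtendParity {𝓢 : Spacetime.{0} 4} (Λ Q : lorentzGroup) (c : E4) (M a : ℝ)
    (hQQ : ∀ v, (Q : E4 ≃L[ℝ] E4) ((Q : E4 ≃L[ℝ] E4) v) = v)
    (hQ0 : (Q : E4 ≃L[ℝ] E4) (E4.basisVector 0) = E4.basisVector 0)
    (hQu : (Q : E4 ≃L[ℝ] E4) ((Λ : E4 ≃L[ℝ] E4).symm (E4.basisVector 0)) =
      (Λ : E4 ≃L[ℝ] E4).symm (E4.basisVector 0))
    (hQ3 : ∀ v, (Q : E4 ≃L[ℝ] E4) v 3 = v 3)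
    (θ : (boostedKerrBackground (Λ * Q) c M a).domain → (boostedKerrBackground Λ c M a).domain)
    (hθ : ∀ x, (θ x).1 = c + ((Λ * Q * Λ⁻¹ : lorentzGroup) : E4 ≃L[ℝ] E4) (x.1 - c))
    (Ψ : (boostedKerrBackground Λ c M a).domain → 𝓢.carrier) (hΨ : ContMDiff 𝓘(ℝ, E4) (𝓡 4) ∞ Ψ) :
    𝓢.deviationExtend (boostedKerrBackground (Λ * Q) c M a) (Ψ ∘ θ) =
      bilinPullback (fun x ↦ c + ((Λ * Q * Λ⁻¹ : lorentzGroup) : E4 ≃L[ℝ] E4) (x - c))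
        (𝓢.deviationExtend (boostedKerrBackground Λ c M a) Ψ) := by
  sorry

/-- Registered brick (H4). -/
theorem stub_parityRelabelDecomposition {𝓢 : Spacetime.{0} 4} {O : Set 𝓢.carrier} {k : ℕ}
    (d : FinalStateDecomposition 𝓢 O k) (R₀ : ℝ) (Q : Fin d.N → lorentzGroup)
    (hQQ : ∀ i v, (Q i : E4 ≃L[ℝ] E4) ((Q i : E4 ≃L[ℝ] E4) v) = v)
    (hQ0 : ∀ i, (Q i : E4 ≃L[ℝ] E4) (E4.basisVector 0) = E4.basisVector 0)
    (hQu : ∀ i, (Q i : E4 ≃L[ℝ] E4) (((d.motion i).1 : E4 ≃L[ℝ] E4).symm (E4.basisVector 0)) =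
      ((d.motion i).1 : E4 ≃L[ℝ] E4).symm (E4.basisVector 0))
    (hQ3 : ∀ i v, (Q i : E4 ≃L[ℝ] E4) v 3 = v 3)
    (hc : Theorems.GapDecaySuffices.Negative.Relabel.HonestCoreOf d R₀)
    (hdv : Theorems.GapDecaySuffices.Negative.Relabel.DistinctLabels d) :
    ∃ d' : FinalStateDecomposition 𝓢 O k, d'.charted = d.charted ∧ d'.flatDomain = d.flatDomain ∧
      d'.τ₀ = d.τ₀ ∧
      (∀ (y : E4) (hy : y ∈ d.flatDomain) (hy' : y ∈ d'.flatDomain), d'.flatChart ⟨y, hy'⟩ = d.flatChart ⟨y, hy⟩) ∧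
      Theorems.GapDecaySuffices.Negative.Relabel.HonestCoreOf d' R₀ ∧
      Theorems.GapDecaySuffices.Negative.Relabel.DistinctLabels d' ∧
      ∃ e : d'.N = d.N, ∀ i : Fin d'.N,
        d'.motion i = ((d.motion (Fin.cast e i)).1 * Q (Fin.cast e i), (d.motion (Fin.cast e i)).2) ∧
        d'.excision i = d.excision (Fin.cast e i) ∧
        ∀ pr : ℝ → ℝ → ℝ → Prop,
          d'.chart i '' {x | pr ((d'.background i).time x.1) ((d'.background i).radius x.1) (x.1 0)} =
            d.chart (Fin.cast e i) '' {x | pr ((d.background (Fin.cast e i)).time x.1)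
              ((d.background (Fin.cast e i)).radius x.1) (x.1 0)} := by
  sorry

end Summit.FinalStateConjecture.FinalStateConjecture.Cruxes.GapDecaySuffices.Sketch

end
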